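import Summits.CriticalPhenomena.SAWScalingLimit.Theorems.SAWTotalPositivityBoundaryTP2Defs
import Summits.CriticalPhenomena.SAWScalingLimit.Theorems.SAWTotalPositivityBoundaryTP2Kernel
import Summits.CriticalPhenomena.SAWScalingLimit.Theorems.SAWTotalPositivityBoundaryTP2Symmetry
import Summits.CriticalPhenomena.SAWScalingLimit.Theorems.SAWTotalPositivityBoundaryTP2RectReflect
import Summits.CriticalPhenomena.SAWScalingLimit.Theorems.SAWTotalPositivityBoundaryTP2LadderBottomRowAdjacent
import Summits.CriticalPhenomena.SAWScalingLimit.Theorems.SAWTotalPositivityBoundaryTP2LadderBottomRowNested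
import Summits.CriticalPhenomena.SAWScalingLimit.Theorems.EdgeOfPositivity.Negative.EdgeOfPositivityRectDomain
import HarnessLib

/-!
# Crux `BoundaryTP2` (stmt-CriticalPhenomena-7115), line `Sketch`: four top sites of a ladder

Dispatcher stub `ladder_ccw_tttt` of the line's skeleton: on the ladder
`R_L = discreteDomainGraph (rectDomain L 1) 1` (sites `{0..L} × {0,1}`), four TOP-row sites visited in
counter-clockwise order have decreasing columns `d₁ > d₂ > d₃ > d₄` (the top side is traversed right to
left).  For `0 ≤ x ≤ 1/2` both non-crossing pairings weigh at least the crossing one: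

  `Z((d₁,1),(d₃,1)) Z((d₂,1),(d₄,1)) ≤ Z((d₁,1),(d₂,1)) Z((d₃,1),(d₄,1))`  (adjacent),
  `Z((d₁,1),(d₃,1)) Z((d₂,1),(d₄,1)) ≤ Z((d₁,1),(d₄,1)) Z((d₂,1),(d₃,1))`  (nested).

Proof. The row reflection `(i,j) ↦ (i,1-j)` is an automorphism of the ladder, so every top-row kernel
equals the corresponding bottom-row kernel (`stub_rect_reflect`, second conjunct, with `b = 1`).  On the
bottom row the two inequalities are the landed `stub_ladder_bottomRow_adjacent` /
`stub_ladder_bottomRow_nested` at the increasing columns `(c₁,c₂,c₃,c₄) := (d₄,d₃,d₂,d₁)`, after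
reversing every kernel (`pathKernel_comm`) and commuting the two products.
-/

noncomputable section

namespace Summit.CriticalPhenomena.SAWScalingLimit.Theorems.BoundaryTP2

open Literature.Probability.LatticeModels Literature.Probability.RandomPlanarGeometry
open Summit.CriticalPhenomena.SAWScalingLimit.Theorems.EdgeOfPositivity.Negative
open scoped ENNReal

/-- Row reflection `(i,j) ↦ (i,1-j)` of the ladder `{0..L}×{0,1}`: a top-row kernel equals the
corresponding bottom-row kernel (`stub_rect_reflect` with `b = 1`). [folklore] -/
private theorem ladderTttt_rowReflect (L : ℕ) (x : ℝ) (i i' : ℤ) :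
    pathKernel (discreteDomainGraph (rectDomain L 1) 1) x (st i 1) (st i' 1) =
      pathKernel (discreteDomainGraph (rectDomain L 1) 1) x (st i 0) (st i' 0) := by
  have h := (stub_rect_reflect L 1 x i 1 i' 1).2
  simpa using h

/-- **Dispatcher stub `ladder_ccw_tttt`.** Four TOP sites of the ladder `{0..L}×{0,1}` in
counter-clockwise order, i.e. columns `d₄ < d₃ < d₂ < d₁ ≤ L` visited as `(d₁,1),(d₂,1),(d₃,1),(d₄,1)`,
`0 ≤ x ≤ 1/2`: both non-crossing pairings beat the crossing one — the bottom-row lemmas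
`stub_ladder_bottomRow_adjacent` / `stub_ladder_bottomRow_nested` transported by the row reflection
`(i,j) ↦ (i,1-j)` (`stub_rect_reflect`). [folklore] -/
theorem ladder_ccw_tttt (L : ℕ) {d₁ d₂ d₃ d₄ : ℕ} (h₄₃ : d₄ < d₃) (h₃₂ : d₃ < d₂) (h₂₁ : d₂ < d₁) (h₁ : d₁ ≤ L)
    {x : ℝ} (hx0 : 0 ≤ x) (hx : x ≤ 1 / 2) :
    (pathKernel (discreteDomainGraph (rectDomain L 1) 1) x (st d₁ 1) (st d₃ 1) *
        pathKernel (discreteDomainGraph (rectDomain L 1) 1) x (st d₂ 1) (st d₄ 1) ≤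
      pathKernel (discreteDomainGraph (rectDomain L 1) 1) x (st d₁ 1) (st d₂ 1) *
        pathKernel (discreteDomainGraph (rectDomain L 1) 1) x (st d₃ 1) (st d₄ 1)) ∧
    (pathKernel (discreteDomainGraph (rectDomain L 1) 1) x (st d₁ 1) (st d₃ 1) *
        pathKernel (discreteDomainGraph (rectDomain L 1) 1) x (st d₂ 1) (st d₄ 1) ≤
      pathKernel (discreteDomainGraph (rectDomain L 1) 1) x (st d₁ 1) (st d₄ 1) *
        pathKernel (discreteDomainGraph (rectDomain L 1) 1) x (st d₂ 1) (st d₃ 1)) := by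
  -- the bottom-row lemmas at the increasing columns `d₄ < d₃ < d₂ < d₁ ≤ L`
  have hA := stub_ladder_bottomRow_adjacent L h₄₃ h₃₂ h₂₁ h₁ hx0 hx
  have hN := stub_ladder_bottomRow_nested L h₄₃ h₃₂ h₂₁ h₁ hx0 hx
  -- reverse every kernel so that the larger column comes first
  rw [pathKernel_comm _ x (st d₄ 0) (st d₂ 0), pathKernel_comm _ x (st d₃ 0) (st d₁ 0),
    pathKernel_comm _ x (st d₄ 0) (st d₃ 0), pathKernel_comm _ x (st d₂ 0) (st d₁ 0)] at hA
  rw [pathKernel_comm _ x (st d₄ 0) (st d₂ 0), pathKernel_comm _ x (st d₃ 0) (st d₁ 0),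
    pathKernel_comm _ x (st d₄ 0) (st d₁ 0), pathKernel_comm _ x (st d₃ 0) (st d₂ 0)] at hN
  -- move the goal to the bottom row by the row reflection
  simp only [ladderTttt_rowReflect]
  exact ⟨(mul_comm _ _).trans_le (hA.trans_eq (mul_comm _ _)), (mul_comm _ _).trans_le hN⟩

end Summit.CriticalPhenomena.SAWScalingLimit.Theorems.BoundaryTP2
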